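/-
Copyright (c) 2026. All rights reserved.
Released under Apache 2.0 license as described in the file LICENSE.
Authors: abc-iut cell, prover seat abc-iut-L4-d3 (gen 11; DELTA #4 probe co-reader, abc-iut-L4-lead m192 (3)), over
abc-iut-L4-t10's sufficiency `cor510MonoContactHolCompatible_of` (`LogFrobeniusMonoTelecoreHolCompatibleOf.lean`) and
abc-iut-w6-d025's carriers (`LogFrobeniusSettingSumCoherence.lean`, `AutHolFieldFunctorMonoAnalyticization.lean`,
`LogFrobeniusArchGenuineIotaAnMono.lean`) — consumed BY NAME, nothing restated.
-/
import Literature.AnabelianGeometry.AbsoluteAnabelian.LogFrobeniusMonoTelecoreHolCompatibleOf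
import Literature.AnabelianGeometry.AbsoluteAnabelian.LogFrobeniusSettingSumCoherence
import Literature.AnabelianGeometry.AbsoluteAnabelian.ArchimedeanHolFieldFunctorGeometric
import HarnessLib

/-!
# [AbsTopIII] Cor 5.10 (iv)(c), «compatible with `𝔗_{An•}`, `ℋ_{An•}`»: the typed sentence HOLDS at genuine carriers of BOTH place types

S. Mochizuki, *Topics in absolute anabelian geometry III: global reconstruction algorithms* [MochizukiAbsTopIII2015];
manuscript `paper:url-5493eb38cbb7`, read on the page (cell render `AbsTopIII-kurims-url-5493eb38cbb7`): Cor 5.10 (iv)(c)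
p. 148 l. 41–45 («… generate a contact structure `ℋ_{An⊢}` on `𝔗_{An⊢}` that is compatible with the telecore and contact
structures `𝔗_{An•}`, `ℋ_{An•}` of Corollary 5.5, (ii) …»), Cor 5.10 preamble p. 146 (the mono-analyticisation arrows and
their homotopies), Def 3.5 (ii) p. 75 («compatible»).

PROOF-ONLY (no definition, no instance, no named fact).  abc-iut-L4-t10 closed this lineage's typed sentence
`LogFrobeniusSetting.Cor510MonoContactHolCompatible` (p501764) by the sufficiency
`cor510MonoContactHolCompatible_of (hN) (hψ) [Nonempty Vmod]` — inputs: the printed data (a) «rows-4→5 mono-analyticisation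
homotopies» `hN` and (c) «`ψ^{An⊢⊞}` lies over `ℰ⊢`» `hψ` — and instantiated it at abc-iut-f-101's genuine
open-augmentation carrier `genuineOpen p V` (ALL places nonarchimedean; `cor510MonoContactHolCompatible_genuineOpen`).
The sentence involves neither `ι⊞` nor `η⊢`, so — unlike the PINNED (iv)(b)(c) row — it is untouched by the frozen
interface's archimedean over-typing (cell typing finding T3g9-F1) and holds at the FROZEN carriers carrying ARCHIMEDEAN rows
as well.  This file records exactly that, feeding abc-iut-w6-d025's carrier data by name:

* `cor510MonoContactHolCompatible_archGenuineMonoAnChart` — at abc-iut-w6-d025's archimedean chart setting over ANY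
  Aut-holomorphic field functor `𝔄` (`hN := (archGenuineMonoAnChart_monoAnalyticizationHomotopies …).toE`,
  `hψ := archGenuineMonoAnChart_ψOverIso`), every index, `V ≠ ∅`;
* ★ `cor510MonoContactHolCompatible_genuineTwoSidedSum` — at the TWO-SIDED sum `genuineTwoSidedSum p 𝔄 V₁ V₂` (abc-iut-f-101's
  genuine open-augmentation rows at the places of `V₁`; abc-iut-w6-d025's archimedean chart setting at the places of `V₂`:
  genuine `ψArc`, genuine `ℰ• = EA → ℰ⊢ = TM⊢`, the `TB⊞`-component of `𝒩⊞_v → 𝒩⊢⊞_v` constant — its label (L1′); the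
  carrier of record of the cell's COUNT-READ DELTA #3 for the archimedean reading), `V₁ ⊕ V₂ ≠ ∅`: **both place types in ONE
  setting, ZERO further hypotheses**; `_iff` forms (exactly `≠ ∅`, abc-iut-L4-t10's `cor510MonoContactHolCompatible_iff_nonempty`);
* `cor510MonoContactHolCompatible_genuineTwoSidedSum_geometric` — the concrete instance at the geometric Aut-holomorphic
  field functor on all connected Riemann surfaces, `p = 2`, one place of each type; `exists_twoSided_cor510MonoContactHolCompatible`.

HONEST LABELS: MODEL-LEVEL (carriers of the cell's construction); the typed sentence is this lineage's reading with the
ℋ-UNIVERSAL scope (abc-iut-L4-lead m180: the contact structures are binders, `ℋ := 𝒥` on both sides in abc-iut-L4-t10's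
witness; the pinned `monoContact` is not addressed); FROZEN interface (no `⋉` twin needed for THIS sentence).  Refereed
pre-IUT material; nothing here bears on [IUTchIII] Cor. 3.12; no side taken; typed ≠ proved for print's theaters.
-/

set_option autoImplicit false

open CategoryTheory

namespace Literature.AnabelianGeometry.AbsoluteAnabelian

namespace LogFrobeniusSetting

universe u

/-! ## At abc-iut-w6-d025's archimedean chart setting -/

section Arc

variable (𝔄 : AutHolFieldFunctor.{u}) (Vmod : Type (u + 1)) (isArc : Vmod → Bool)

/-- **The holomorphic-compatibility sentence of Cor 5.10 (iv)(c) HOLDS at the archimedean chart setting `archGenuineMonoAnChart 𝔄`**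
over every Aut-holomorphic field functor and every nonempty index: abc-iut-L4-t10's sufficiency fed with abc-iut-w6-d025's
mono-analyticisation homotopies (`toE`, an `eqToIso`) and «`ψ` over `ℰ⊢`» (`archGenuineMonoAnChart_ψOverIso`).
[cite: MochizukiAbsTopIII2015, Cor 5.10 (iv)(c) p. 148] -/
theorem cor510MonoContactHolCompatible_archGenuineMonoAnChart [Nonempty Vmod] :
    (archGenuineMonoAnChart 𝔄 Vmod isArc).Cor510MonoContactHolCompatible :=
  (archGenuineMonoAnChart 𝔄 Vmod isArc).cor510MonoContactHolCompatible_of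
    (archGenuineMonoAnChart_monoAnalyticizationHomotopies 𝔄 Vmod isArc).toE
    (archGenuineMonoAnChart_ψOverIso 𝔄 Vmod isArc)

/-- … EXACTLY iff the index is nonempty. [cite: MochizukiAbsTopIII2015, Cor 5.10 (iv)(c) p. 148] -/
theorem cor510MonoContactHolCompatible_archGenuineMonoAnChart_iff :
    (archGenuineMonoAnChart 𝔄 Vmod isArc).Cor510MonoContactHolCompatible ↔ Nonempty Vmod :=
  (archGenuineMonoAnChart 𝔄 Vmod isArc).cor510MonoContactHolCompatible_iff_nonempty
    (archGenuineMonoAnChart_monoAnalyticizationHomotopies 𝔄 Vmod isArc).toE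
    (archGenuineMonoAnChart_ψOverIso 𝔄 Vmod isArc)

end Arc

/-! ## At the two-sided sum: BOTH place types in one setting -/

section TwoSided

variable (p : ℕ) [Fact p.Prime] (𝔄 : AutHolFieldFunctor.{0}) (V₁ V₂ : Type 1)

/-- ★ **The holomorphic-compatibility sentence of Cor 5.10 (iv)(c) HOLDS at abc-iut-w6-d025's two-sided sum
`genuineTwoSidedSum p 𝔄 V₁ V₂`** — genuine open-augmentation rows at the nonarchimedean places (`V₁`), genuine archimedean `ψArc`
rows at the archimedean places (`V₂`) — for `V₁ ⊕ V₂ ≠ ∅`, with NO further hypothesis: abc-iut-L4-t10's sufficiency fed with the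
sum's mono-analyticisation homotopies (`genuineTwoSidedSum_monoAnalyticizationHomotopies`, `toE`) and the sum's «`ψ` over `ℰ⊢`»
(`genuineTwoSidedSum_ψOverIso`). [cite: MochizukiAbsTopIII2015, Cor 5.10 (iv)(c) p. 148] -/
theorem cor510MonoContactHolCompatible_genuineTwoSidedSum [Nonempty (V₁ ⊕ V₂)] :
    (genuineTwoSidedSum p 𝔄 V₁ V₂).Cor510MonoContactHolCompatible :=
  (genuineTwoSidedSum p 𝔄 V₁ V₂).cor510MonoContactHolCompatible_of
    (genuineTwoSidedSum_monoAnalyticizationHomotopies p 𝔄 V₁ V₂).toE (genuineTwoSidedSum_ψOverIso p 𝔄 V₁ V₂)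

/-- … EXACTLY iff `V₁ ⊕ V₂ ≠ ∅`. [cite: MochizukiAbsTopIII2015, Cor 5.10 (iv)(c) p. 148] -/
theorem cor510MonoContactHolCompatible_genuineTwoSidedSum_iff :
    (genuineTwoSidedSum p 𝔄 V₁ V₂).Cor510MonoContactHolCompatible ↔ Nonempty (V₁ ⊕ V₂) :=
  (genuineTwoSidedSum p 𝔄 V₁ V₂).cor510MonoContactHolCompatible_iff_nonempty
    (genuineTwoSidedSum_monoAnalyticizationHomotopies p 𝔄 V₁ V₂).toE (genuineTwoSidedSum_ψOverIso p 𝔄 V₁ V₂)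

end TwoSided

end LogFrobeniusSetting

/-! ## The concrete geometric instance -/

namespace HolRS

open LogFrobeniusSetting

/-- **Concrete, no variable left**: at the geometric Aut-holomorphic field functor on all connected Riemann surfaces (`Q := ⊤`),
`p = 2`, one nonarchimedean and one archimedean place, the holomorphic-compatibility sentence of Cor 5.10 (iv)(c) holds at the
two-sided sum. [cite: MochizukiAbsTopIII2015, Cor 5.10 (iv)(c) p. 148] -/
theorem cor510MonoContactHolCompatible_genuineTwoSidedSum_geometric :
    (genuineTwoSidedSum 2 (geometricAutHolFieldFunctor ⊤) PUnit.{2} PUnit.{2}).Cor510MonoContactHolCompatible :=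
  cor510MonoContactHolCompatible_genuineTwoSidedSum 2 (geometricAutHolFieldFunctor ⊤) PUnit PUnit

/-- Existence form: a §5 setting over a two-sided index (`isArc = Sum.elim (fun _ ↦ false) (fun _ ↦ true)`) carrying genuine
rows at both place types and satisfying the typed holomorphic-compatibility sentence EXISTS, for every prime, every
Aut-holomorphic field functor and all index sets with `V₁ ⊕ V₂ ≠ ∅`. [cite: MochizukiAbsTopIII2015, Cor 5.10 (iv)(c) p. 148] -/
theorem exists_twoSided_cor510MonoContactHolCompatible (p : ℕ) [Fact p.Prime] (𝔄 : AutHolFieldFunctor.{0}) (V₁ V₂ : Type 1)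
    [Nonempty (V₁ ⊕ V₂)] :
    ∃ L : LogFrobeniusSetting (V₁ ⊕ V₂) (Sum.elim (fun _ => false) (fun _ => true)), L.Cor510MonoContactHolCompatible :=
  ⟨genuineTwoSidedSum p 𝔄 V₁ V₂, cor510MonoContactHolCompatible_genuineTwoSidedSum p 𝔄 V₁ V₂⟩

end HolRS

end Literature.AnabelianGeometry.AbsoluteAnabelian
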